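import Summits.QuantumFields.YangMills.Theses.RenyiTelescope

/-!
# Route `RenyiTelescope` — what the repaired crux `CutoffRenyiLR` FORCES: absolute continuity of consecutive interior-conditioned unit laws
# (structure probe; helper for crux `HistoryTailL` = stmt-QuantumFields-19936 via its registered line `Cruxes/HistoryTailL/Lines/renyi_telescope_r.lean`,
# whose stub `stub_cutoffRenyiR` IS `CutoffRenyiLR` = stmt-QuantumFields-27544; width seat ym-ust-19936-w5 g5)

THE POINT.  The repaired crux `CutoffRenyiLR` (Hölder-event form of an order-`q` Rényi comparison of the interior-conditioned unit-scale laws at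
cut-offs `J` and `J+1`, exponent `R₀(q−1)p⁴L^(3F.m)(γ²/L^(2J) + 1/L^(4J))`, orders `1 < q ≤ Q·L^J`) has, for EVERY admissible order `q`, the factor
`P_J(unitA⁻¹A ∩ Int_J)^(1 − 1/q)` on its right-hand side with a STRICTLY POSITIVE exponent `1 − 1/q`.  Hence, with no limit `q → 1⁺` needed,
`0^(1−1/q) = 0` gives (`absCont_of_cutoffRenyiLR`): whenever an order is admissible at cut-off `J` (`1 < Q·L^J`), every `unitA`-measurable event
that is NULL for the interior-restricted Gibbs law at cut-off `J` while the interior event itself is charged (`0 < P_J(Int_J)`) is NULL for the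
interior-restricted Gibbs law at cut-off `J+1`:
  `P_J(unitA_J⁻¹ A ∩ Int_J) = 0 ∧ 0 < P_J(Int_J) ⟹ P_(J+1)(unitA_(J+1)⁻¹ A ∩ Int_(J+1)) = 0`.
In words: the «a.c. defects of the unit push-forwards» listed under 27544's why-it-might-fail are not a side risk but an OBLIGATION of any proof —
the push-forward under `unitA F ℰp (J+1)` of `gibbsK … (J+1)` restricted to `histGoodInt … (J+1) 1` must be absolutely continuous with respect to
the push-forward under `unitA F ℰp J` of `gibbsK … J` restricted to `histGoodInt … J 1` (as soon as the latter interior event is non-null).  This is the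
concrete attack surface for the route's refuter / instrument seats: ONE measurable unit-scale event `A` null at cut-off `J` and charged at cut-off
`J+1` (e.g. through a difference of the RANGES of the `J`-fold and `(J+1)`-fold exp-mean-log block averages on good histories) refutes 27544 as typed.
A companion (`pos_of_cutoffRenyiLR`) records the contrapositive in the form the telescope consumes: a unit event charged at cut-off `J+1` on the
interior is charged at cut-off `J`; `map_restrict_absolutelyContinuous_of_cutoffRenyiLR` states the same as `Measure.AbsolutelyContinuous` of the
two push-forward measures `Measure.map (unitA F ℰp (J+1)) ((gibbsK … (J+1)).restrict Int_(J+1)) ≪ Measure.map (unitA F ℰp J) ((gibbsK … J).restrict Int_J)`.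

WHAT THIS IS NOT: `CutoffRenyiLR` is a HYPOTHESIS here and stays open (XL); nothing is claimed about whether the forced absolute continuity holds
for the Wilson tower; nothing here bears on the Yang–Mills mass gap; the rung R3 (`YM3TorusSU2`) and the crux `HistoryTailL` are NOT proved.
YM₃ on the three-torus is rung R3 of the programme, NOT the Clay problem.

References: T. Bałaban, CMP 102 (1985) 255–275 [Balaban1985UV3] ((7) p.257, (71) p.273); C. King, CMP 103 (1986) 323–349 [King1986] (Thm 3.4);
T. van Erven, P. Harremoës, IEEE Trans. Inf. Theory 60 (2014) 3797–3820 (Rényi divergence, Thm 8: the event form and absolute continuity at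
every order `q > 1`).
-/

noncomputable section

open MeasureTheory
open Literature.MathematicalPhysics.QuantumFieldTheory.Balaban1983to89
open Literature.MathematicalPhysics.QuantumFieldTheory.Balaban1983to89.T3ContinuumYM3Torus
open Literature.MathematicalPhysics.QuantumFieldTheory.Balaban1983to89.T3UnitScaleTilt
open Literature.MathematicalPhysics.QuantumFieldTheory.Balaban1983to89.T3UnitLawDensityEML
open Literature.MathematicalPhysics.QuantumFieldTheory.Balaban1983to89.T3InteriorExcision

namespace Summit.QuantumFields.YangMills.Theorems.RenyiTelescope

/-- Arithmetic core: if `a · b^e ≤ C · 0^e · D` with `0 ≤ a`, `0 < b` and `0 < e`, then `a = 0`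
(`0^e = 0` for a non-zero real exponent, `b^e > 0`). [folklore] -/
theorem eq_zero_of_mul_rpow_le_mul_zero_rpow {a b C D e : ℝ} (ha : 0 ≤ a) (hb : 0 < b) (he : 0 < e)
    (h : a * b ^ e ≤ C * (0 : ℝ) ^ e * D) : a = 0 := by
  rw [Real.zero_rpow he.ne', mul_zero, zero_mul] at h
  have hbe : 0 < b ^ e := Real.rpow_pos_of_pos hb e
  nlinarith [mul_nonneg ha hbe.le]

/-- **ABSOLUTE CONTINUITY FORCED BY THE REPAIRED CRUX.**  `CutoffRenyiLR` implies: for every block size `L` there are the crux's interior ratio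
`c` and thresholds, and for every profile above them the crux's `γ₁, Q`, such that for every family `F` (`F.L = L`), every `0 < γ ≤ γ₁` and every
cut-off `J ≥ 1` at which some Hölder order is admissible (`1 < Q·L^J`), every measurable unit-scale event `A` whose `unitA`-preimage is NULL for
run `J`'s Gibbs law restricted to the interior event `Int_J = histGoodInt F θBal(b₀) θBal(c·b₀)(1) J 1`, with `Int_J` itself charged, has NULL
`unitA`-preimage for run `J+1`'s Gibbs law restricted to `Int_(J+1)` — i.e. the interior-conditioned unit law at cut-off `J+1` is absolutely
continuous w.r.t. the one at cut-off `J`.  Proof: instantiate the crux at the admissible order `q := Q·L^J`; its right-hand side carries the factor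
`P_J(unitA⁻¹A ∩ Int_J)^(1−1/q) = 0^(1−1/q) = 0`. [cite: King1986, Thm 3.4 (3.9) p.656; Balaban1985UV3, (7) p.257] -/
theorem absCont_of_cutoffRenyiLR
    (hR : Summit.QuantumFields.YangMills.Theses.RenyiTelescope.CutoffRenyiLR) :
    ∀ (L : ℕ), ∃ (c b₁ p₁ : ℝ), 0 < c ∧ c ≤ 1 ∧ ∀ (b₀ p₀ : ℝ), b₁ ≤ b₀ → p₁ ≤ p₀ → 0 < b₀ → 2 < p₀ →
      ∃ (γ₁ Q : ℝ), 0 < γ₁ ∧ γ₁ ≤ 1 ∧ 0 < Q ∧ ∀ (F : T3Family) (γ : ℝ), F.L = L → 0 < γ → γ ≤ γ₁ →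
        ∀ (J : ℕ), 1 ≤ J → 1 < Q * (L : ℝ) ^ J →
          ∀ (A : Set (GaugeField (F.P 0) 0 (Matrix.specialUnitaryGroup (Fin 2) ℂ))), MeasurableSet A →
            (gibbsK F ℰp γ J).real ((unitA F ℰp J) ⁻¹' A ∩
                histGoodInt F (θBal L γ b₀ p₀) (θBal L γ (c * b₀) p₀ 1) J 1) = 0 →
            0 < (gibbsK F ℰp γ J).real (histGoodInt F (θBal L γ b₀ p₀) (θBal L γ (c * b₀) p₀ 1) J 1) →
            (gibbsK F ℰp γ (J + 1)).real ((unitA F ℰp (J + 1)) ⁻¹' A ∩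
                histGoodInt F (θBal L γ b₀ p₀) (θBal L γ (c * b₀) p₀ 1) (J + 1) 1) = 0 := by
  intro L
  obtain ⟨c, b₁, p₁, hc0, hc1, h1⟩ := hR L
  refine ⟨c, b₁, p₁, hc0, hc1, fun b₀ p₀ hb hp hb0 hp2 => ?_⟩
  obtain ⟨γ₁, Q, R₀, hγ₁0, hγ₁1, hQ, h2⟩ := h1 b₀ p₀ hb hp hb0 hp2
  refine ⟨γ₁, Q, hγ₁0, hγ₁1, hQ, fun F γ hFL hγ0 hγ1 J hJ hQJ A hA hnull hpos => ?_⟩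
  -- the admissible order `q := Q·L^J`
  have hcrux := h2 F γ hFL hγ0 hγ1 J (Q * (L : ℝ) ^ J) hJ hQJ le_rfl A hA
  rw [hnull] at hcrux
  have he : 0 < 1 - 1 / (Q * (L : ℝ) ^ J) := by
    have h1q : 1 / (Q * (L : ℝ) ^ J) < 1 := (div_lt_one (lt_trans one_pos hQJ)).mpr hQJ
    linarith
  exact eq_zero_of_mul_rpow_le_mul_zero_rpow measureReal_nonneg hpos he hcrux

/-- **THE CONTRAPOSITIVE, in the form the telescope consumes**: under `CutoffRenyiLR`, at every cut-off `J ≥ 1` with an admissible order and a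
charged interior event `Int_J`, a measurable unit-scale event whose preimage is CHARGED for run `J+1` restricted to `Int_(J+1)` is already charged
for run `J` restricted to `Int_J`. [cite: King1986, Thm 3.4 (3.9) p.656; Balaban1985UV3, (7) p.257] -/
theorem pos_of_cutoffRenyiLR
    (hR : Summit.QuantumFields.YangMills.Theses.RenyiTelescope.CutoffRenyiLR) :
    ∀ (L : ℕ), ∃ (c b₁ p₁ : ℝ), 0 < c ∧ c ≤ 1 ∧ ∀ (b₀ p₀ : ℝ), b₁ ≤ b₀ → p₁ ≤ p₀ → 0 < b₀ → 2 < p₀ →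
      ∃ (γ₁ Q : ℝ), 0 < γ₁ ∧ γ₁ ≤ 1 ∧ 0 < Q ∧ ∀ (F : T3Family) (γ : ℝ), F.L = L → 0 < γ → γ ≤ γ₁ →
        ∀ (J : ℕ), 1 ≤ J → 1 < Q * (L : ℝ) ^ J →
          ∀ (A : Set (GaugeField (F.P 0) 0 (Matrix.specialUnitaryGroup (Fin 2) ℂ))), MeasurableSet A →
            0 < (gibbsK F ℰp γ J).real (histGoodInt F (θBal L γ b₀ p₀) (θBal L γ (c * b₀) p₀ 1) J 1) →
            0 < (gibbsK F ℰp γ (J + 1)).real ((unitA F ℰp (J + 1)) ⁻¹' A ∩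
                histGoodInt F (θBal L γ b₀ p₀) (θBal L γ (c * b₀) p₀ 1) (J + 1) 1) →
            0 < (gibbsK F ℰp γ J).real ((unitA F ℰp J) ⁻¹' A ∩
                histGoodInt F (θBal L γ b₀ p₀) (θBal L γ (c * b₀) p₀ 1) J 1) := by
  intro L
  obtain ⟨c, b₁, p₁, hc0, hc1, h1⟩ := absCont_of_cutoffRenyiLR hR L
  refine ⟨c, b₁, p₁, hc0, hc1, fun b₀ p₀ hb hp hb0 hp2 => ?_⟩
  obtain ⟨γ₁, Q, hγ₁0, hγ₁1, hQ, h2⟩ := h1 b₀ p₀ hb hp hb0 hp2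
  refine ⟨γ₁, Q, hγ₁0, hγ₁1, hQ, fun F γ hFL hγ0 hγ1 J hJ hQJ A hA hpos hch => ?_⟩
  rcases (measureReal_nonneg (μ := gibbsK F ℰp γ J)
      (s := (unitA F ℰp J) ⁻¹' A ∩ histGoodInt F (θBal L γ b₀ p₀) (θBal L γ (c * b₀) p₀ 1) J 1)).lt_or_eq with hlt | heq
  · exact hlt
  · exact absurd (h2 F γ hFL hγ0 hγ1 J hJ hQJ A hA heq.symm hpos) hch.ne'

/-- **THE SAME, AS A STATEMENT ABOUT MEASURES** (`Measure.AbsolutelyContinuous`): under `CutoffRenyiLR`, at every cut-off `J ≥ 1` with an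
admissible order and a charged interior event, the push-forward under the unit transport `unitA F ℰp (J+1)` of run `J+1`'s Gibbs law restricted
to `Int_(J+1)` is ABSOLUTELY CONTINUOUS with respect to the push-forward under `unitA F ℰp J` of run `J`'s Gibbs law restricted to `Int_J`
(`Measure.AbsolutelyContinuous.mk`: it suffices to test measurable unit-scale events, which is `absCont_of_cutoffRenyiLR`).
[cite: King1986, Thm 3.4 (3.9) p.656; Balaban1985UV3, (7) p.257] -/
theorem map_restrict_absolutelyContinuous_of_cutoffRenyiLR
    (hR : Summit.QuantumFields.YangMills.Theses.RenyiTelescope.CutoffRenyiLR) :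
    ∀ (L : ℕ), ∃ (c b₁ p₁ : ℝ), 0 < c ∧ c ≤ 1 ∧ ∀ (b₀ p₀ : ℝ), b₁ ≤ b₀ → p₁ ≤ p₀ → 0 < b₀ → 2 < p₀ →
      ∃ (γ₁ Q : ℝ), 0 < γ₁ ∧ γ₁ ≤ 1 ∧ 0 < Q ∧ ∀ (F : T3Family) (γ : ℝ), F.L = L → 0 < γ → γ ≤ γ₁ →
        ∀ (J : ℕ), 1 ≤ J → 1 < Q * (L : ℝ) ^ J →
          0 < (gibbsK F ℰp γ J).real (histGoodInt F (θBal L γ b₀ p₀) (θBal L γ (c * b₀) p₀ 1) J 1) →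
          (Measure.map (unitA F ℰp (J + 1))
              ((gibbsK F ℰp γ (J + 1)).restrict (histGoodInt F (θBal L γ b₀ p₀) (θBal L γ (c * b₀) p₀ 1) (J + 1) 1))).AbsolutelyContinuous
            (Measure.map (unitA F ℰp J)
              ((gibbsK F ℰp γ J).restrict (histGoodInt F (θBal L γ b₀ p₀) (θBal L γ (c * b₀) p₀ 1) J 1))) := by
  intro L
  obtain ⟨c, b₁, p₁, hc0, hc1, h1⟩ := absCont_of_cutoffRenyiLR hR L
  refine ⟨c, b₁, p₁, hc0, hc1, fun b₀ p₀ hb hp hb0 hp2 => ?_⟩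
  obtain ⟨γ₁, Q, hγ₁0, hγ₁1, hQ, h2⟩ := h1 b₀ p₀ hb hp hb0 hp2
  refine ⟨γ₁, Q, hγ₁0, hγ₁1, hQ, fun F γ hFL hγ0 hγ1 J hJ hQJ hpos => ?_⟩
  haveI : IsProbabilityMeasure (gibbsK F ℰp γ J) := isProbabilityMeasure_gibbsK F ℰp hγ0.le J
  haveI : IsProbabilityMeasure (gibbsK F ℰp γ (J + 1)) := isProbabilityMeasure_gibbsK F ℰp hγ0.le (J + 1)
  have hmJ : Measurable (unitA F ℰp J) := measurable_unitA F ℰp measurableE_ℰp J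
  have hmJ1 : Measurable (unitA F ℰp (J + 1)) := measurable_unitA F ℰp measurableE_ℰp (J + 1)
  refine Measure.AbsolutelyContinuous.mk fun s hs hs0 => ?_
  rw [Measure.map_apply hmJ hs, Measure.restrict_apply (hmJ hs)] at hs0
  rw [Measure.map_apply hmJ1 hs, Measure.restrict_apply (hmJ1 hs)]
  have h0 : (gibbsK F ℰp γ J).real ((unitA F ℰp J) ⁻¹' s ∩
      histGoodInt F (θBal L γ b₀ p₀) (θBal L γ (c * b₀) p₀ 1) J 1) = 0 := by
    rw [measureReal_def, hs0, ENNReal.toReal_zero]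
  exact (measureReal_eq_zero_iff (measure_ne_top _ _)).mp (h2 F γ hFL hγ0 hγ1 J hJ hQJ s hs h0 hpos)

end Summit.QuantumFields.YangMills.Theorems.RenyiTelescope

end
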